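import Summits.NavierStokesRegularity.NavierStokesRegularity.Theorems.TypeIIInviscidRelaxationAxisymSwirlRegularCoreReynoldsPlateauProfile
import HarnessLib

/-!
# One-sided criterion with the PLATEAU Reynolds profile (core scale `ε`, plateau height `L + 2`)

Helper toward the crux `OneSidedRadialCriterion` (stmt-NavierStokesRegularity-19059; line `subcritical_core_reynolds`),
criterion side; continues `…CoreReynoldsPlateauProfile.lean` (profile `G(s) = s^p(1+s²)^{−a}(1+s^L)^{−b}`,
`p = 2m + 2a + Lb`, and its admissible Reynolds profile
`D(ξ) = 2 − N(s) + M(s)/N(s) + ε² s²(N(s) − 2m)/(2N(s))`, `s = ξ/ε`, `N = 2m + 2a/(1+s²) + bL/(1+s^L)`,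
`M = 4as²/(1+s²)² + bL²s^L/(1+s^L)²`).

* squeeze bounds of the reduction's clause list for `G(·/ε)`: `contDiffOn_/continuousOn_/monotoneOn_scaledPlateau`,
  `scaledPlateau_zero`, `plateauProfile_eq` (`G = s^{2m}(s²/(1+s²))^a(s^L/(1+s^L))^b`), `scaledPlateau_le`
  (`≤ ε^{−2m}ξ^{2m}`), `scaledPlateau_ge_far`, `scaledPlateau_ge_near`;
* `hasSmoothExtensionPast_of_plateauCoreReynolds` — **the criterion**: inflow Reynolds number `≤ D(r/√(ν(T−t)))` on
  the unit tube ⇒ continuation past `T` (`m > 0`, `2m ≤ 1`, `a, b ≥ 0`, `L > 0`, `p < 2`, `ε > 0`).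

Intended use (evidence `CENSUS-19059-hand5g0.md` on ⟨19059⟩, numerically checked recipe `L ≥ Λ₀`, `a ∝ mΛ₀/ε²`,
`m` exponentially small): the two-level criterion with an arbitrarily thin subcritical core for EVERY outer level
`Λ₀` (the `…ThinCore` theorem has `Λ₀ < 4`), hence for ⟨19059⟩ with ANY gate constant the weakening «∀ core width» →
«∃ one core width» of the registered stub.  That regime analysis (pure real inequalities on `D`) is NOT in this file.
Honest label: a regularity CRITERION; nothing here proves `OneSidedRadialCriterion`, `AxisymSwirlRegular` or
NavierStokesRegularity. [new]
-/

noncomputable section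

set_option linter.dupNamespace false

open Set Filter Topology Real
open Literature.Analysis.FluidPDE

namespace Summit.NavierStokesRegularity.NavierStokesRegularity.Theorems.RadialInflowPlateau

open Summit.NavierStokesRegularity.NavierStokesRegularity.Theorems
open Summit.NavierStokesRegularity.NavierStokesRegularity.Theorems.ZhangBarrier
open Summit.NavierStokesRegularity.NavierStokesRegularity.Theorems.RadialInflowSelfSimilar

/-! ## §1 Regularity, monotonicity and the squeeze bounds (`p = 2m + 2a + Lb`) -/

/-- Smoothness of `G` on `(0,∞)`. -/
theorem contDiffOn_plateauProfile (p a b L : ℝ) {n : WithTop ℕ∞} :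
    ContDiffOn ℝ n (fun x : ℝ => x ^ p * (1 + x ^ 2) ^ (-a) * (1 + x ^ L) ^ (-b)) (Ioi 0) := by
  intro x hx
  have hx0 : (0 : ℝ) < x := hx
  have hx' : x ≠ 0 := ne_of_gt hx0
  have h1 : ContDiffAt ℝ n (fun x : ℝ => x ^ p) x := Real.contDiffAt_rpow_const_of_ne hx'
  have h2 : ContDiffAt ℝ n (fun x : ℝ => (1 + x ^ 2) ^ (-a)) x := by
    have hf : ContDiffAt ℝ n (fun x : ℝ => 1 + x ^ 2) x := by fun_prop
    exact hf.rpow_const_of_ne (by positivity)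
  have h3 : ContDiffAt ℝ n (fun x : ℝ => (1 + x ^ L) ^ (-b)) x := by
    have hf : ContDiffAt ℝ n (fun x : ℝ => 1 + x ^ L) x :=
      contDiffAt_const.add (Real.contDiffAt_rpow_const_of_ne hx')
    have hpos : 0 < 1 + x ^ L := by have := Real.rpow_pos_of_pos hx0 L; linarith
    exact hf.rpow_const_of_ne hpos.ne'
  exact ((h1.mul h2).mul h3).contDiffWithinAt

/-- Smoothness of the rescaled profile on `(0,∞)`. -/
theorem contDiffOn_scaledPlateau (p a b L : ℝ) {ε : ℝ} (hε : 0 < ε) {n : WithTop ℕ∞} :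
    ContDiffOn ℝ n (fun y : ℝ => (y / ε) ^ p * (1 + (y / ε) ^ 2) ^ (-a) * (1 + (y / ε) ^ L) ^ (-b))
      (Ioi 0) := by
  have h1 : ContDiffOn ℝ n (fun y : ℝ => y / ε) (Ioi 0) := (contDiff_id.div_const ε).contDiffOn
  exact (contDiffOn_plateauProfile p a b L).comp h1 fun y hy => div_pos hy hε

/-- Continuity of `G` on `[0,∞)` (`p > 0`, `L > 0`). -/
theorem continuousOn_plateauProfile {p a b L : ℝ} (hp : 0 < p) (hL : 0 < L) :
    ContinuousOn (fun x : ℝ => x ^ p * (1 + x ^ 2) ^ (-a) * (1 + x ^ L) ^ (-b)) (Ici 0) := by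
  have h1 : Continuous (fun x : ℝ => x ^ p) := Real.continuous_rpow_const hp.le
  have h2 : Continuous (fun x : ℝ => (1 + x ^ 2) ^ (-a)) := by
    have hf : Continuous (fun x : ℝ => 1 + x ^ 2) := by fun_prop
    exact hf.rpow_const fun x => Or.inl (by positivity)
  have h3 : ContinuousOn (fun x : ℝ => (1 + x ^ L) ^ (-b)) (Ici 0) := by
    have hf : Continuous (fun x : ℝ => 1 + x ^ L) := continuous_const.add (Real.continuous_rpow_const hL.le)
    refine (hf.continuousOn.rpow_const fun x hx => Or.inl ?_)
    have : 0 ≤ x ^ L := Real.rpow_nonneg hx L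
    positivity
  exact ((h1.mul h2).continuousOn).mul h3

/-- Continuity of the rescaled profile on `[0,∞)`. -/
theorem continuousOn_scaledPlateau {p a b L ε : ℝ} (hp : 0 < p) (hL : 0 < L) (hε : 0 < ε) :
    ContinuousOn (fun y : ℝ => (y / ε) ^ p * (1 + (y / ε) ^ 2) ^ (-a) * (1 + (y / ε) ^ L) ^ (-b))
      (Ici 0) := by
  have h1 : ContinuousOn (fun y : ℝ => y / ε) (Ici 0) := (continuous_id.div_const ε).continuousOn
  exact (continuousOn_plateauProfile (a := a) (b := b) hp hL).comp h1 fun y hy => div_nonneg hy hε.le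

/-- The (rescaled) profile vanishes at the axis (`p > 0`). -/
theorem scaledPlateau_zero {p a b L ε : ℝ} (hp : 0 < p) :
    ((0 : ℝ) / ε) ^ p * (1 + ((0 : ℝ) / ε) ^ 2) ^ (-a) * (1 + ((0 : ℝ) / ε) ^ L) ^ (-b) = 0 := by
  rw [zero_div, Real.zero_rpow hp.ne', zero_mul, zero_mul]

/-- Lower bound for the logarithmic derivative: `ℓ(s) ≥ (p − 2a − bL)/s` (`a, b, L ≥ 0`, `s > 0`). -/
theorem plateauLogDeriv_ge {p a b L : ℝ} (ha : 0 ≤ a) (hb : 0 ≤ b) (hL : 0 ≤ L) {s : ℝ} (hs : 0 < s) :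
    (p - 2 * a - b * L) / s
      ≤ p / s - 2 * a * s / (1 + s ^ 2) - b * L * s ^ L / (s * (1 + s ^ L)) := by
  have hsL : 0 < s ^ L := Real.rpow_pos_of_pos hs L
  have h1 : 2 * a * s / (1 + s ^ 2) ≤ 2 * a / s := by
    rw [div_le_div_iff₀ (by positivity) hs]; nlinarith
  have h2 : b * L * s ^ L / (s * (1 + s ^ L)) ≤ b * L / s := by
    rw [div_le_div_iff₀ (by positivity) hs]
    have : 0 ≤ b * L := mul_nonneg hb hL
    nlinarith [mul_nonneg this hsL.le]
  have e : (p - 2 * a - b * L) / s = p / s - 2 * a / s - b * L / s := by field_simp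
  rw [e]; linarith

/-- The (rescaled) profile is nondecreasing on `[0,∞)` (`p > 2a + bL`, i.e. `m > 0`). -/
theorem monotoneOn_scaledPlateau {p a b L ε : ℝ} (ha : 0 ≤ a) (hb : 0 ≤ b) (hL : 0 < L) (hε : 0 < ε)
    (hm : 2 * a + b * L < p) :
    MonotoneOn (fun y : ℝ => (y / ε) ^ p * (1 + (y / ε) ^ 2) ^ (-a) * (1 + (y / ε) ^ L) ^ (-b)) (Ici 0) := by
  have hp : 0 < p := by nlinarith [mul_nonneg hb hL.le]
  refine monotoneOn_of_deriv_nonneg (convex_Ici 0) (continuousOn_scaledPlateau hp hL hε) ?_ ?_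
  · rw [interior_Ici]
    exact fun x hx => (hasDerivAt_scaledPlateau (p := p) (a := a) (b := b) (L := L) hε hx)
      |>.differentiableAt.differentiableWithinAt
  · rw [interior_Ici]
    intro x hx
    rw [(hasDerivAt_scaledPlateau (p := p) (a := a) (b := b) (L := L) hε hx).deriv]
    have hs : 0 < x / ε := div_pos hx hε
    have hsL : 0 < (x / ε) ^ L := Real.rpow_pos_of_pos hs L
    have hℓ : 0 ≤ p / (x / ε) - 2 * a * (x / ε) / (1 + (x / ε) ^ 2)
        - b * L * (x / ε) ^ L / ((x / ε) * (1 + (x / ε) ^ L)) :=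
      le_trans (div_nonneg (by linarith) hs.le) (plateauLogDeriv_ge ha hb hL.le hs)
    have h1 : 0 ≤ (x / ε) ^ p := Real.rpow_nonneg hs.le _
    have h2 : 0 ≤ (1 + (x / ε) ^ 2) ^ (-a) := Real.rpow_nonneg (by positivity) _
    have h3 : 0 ≤ (1 + (x / ε) ^ L) ^ (-b) := Real.rpow_nonneg (by positivity) _
    have h4 : 0 ≤ ε⁻¹ := inv_nonneg.2 hε.le
    positivity

/-- Factorisation `G(s) = s^{2m} (s²/(1+s²))^a (s^L/(1+s^L))^b` for `s > 0` (`p = 2m + 2a + Lb`). -/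
theorem plateauProfile_eq {m a b L : ℝ} {s : ℝ} (hs : 0 < s) :
    s ^ (2 * m + 2 * a + L * b) * (1 + s ^ 2) ^ (-a) * (1 + s ^ L) ^ (-b)
      = s ^ (2 * m) * (s ^ 2 / (1 + s ^ 2)) ^ a * (s ^ L / (1 + s ^ L)) ^ b := by
  have hb2 : 0 < 1 + s ^ 2 := by positivity
  have hsL : 0 < s ^ L := Real.rpow_pos_of_pos hs L
  have hbL : 0 < 1 + s ^ L := by linarith
  have h1 : s ^ (2 * m + 2 * a + L * b) = s ^ (2 * m) * s ^ (2 * a) * s ^ (L * b) := by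
    rw [Real.rpow_add hs, Real.rpow_add hs]
  have h2 : s ^ (2 * a) = (s ^ 2) ^ a := by rw [Real.rpow_mul hs.le, Real.rpow_two]
  have h3 : s ^ (L * b) = (s ^ L) ^ b := by rw [Real.rpow_mul hs.le]
  rw [h1, h2, h3, Real.div_rpow (sq_nonneg s) hb2.le, Real.div_rpow hsL.le hbL.le, Real.rpow_neg hb2.le,
    Real.rpow_neg hbL.le, div_eq_mul_inv, div_eq_mul_inv]
  ring

/-- Upper bound `F(ξ) ≤ ε^{−2m} ξ^{2m}` on `[0,∞)`. -/
theorem scaledPlateau_le {m a b L ε : ℝ} (hm : 0 < m) (ha : 0 ≤ a) (hb : 0 ≤ b) (hL : 0 < L) (hε : 0 < ε)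
    {ξ : ℝ} (hξ : 0 ≤ ξ) :
    (ξ / ε) ^ (2 * m + 2 * a + L * b) * (1 + (ξ / ε) ^ 2) ^ (-a) * (1 + (ξ / ε) ^ L) ^ (-b)
      ≤ (ε ^ (2 * m))⁻¹ * ξ ^ (2 * m) := by
  have hp : 0 < 2 * m + 2 * a + L * b := by nlinarith [mul_nonneg hL.le hb]
  rcases hξ.eq_or_lt with h0 | hpos
  · rw [← h0, scaledPlateau_zero hp, Real.zero_rpow (by positivity)]; simp
  have hs : 0 < ξ / ε := div_pos hpos hε
  rw [plateauProfile_eq hs, Real.div_rpow hξ hε.le (2 * m), inv_mul_eq_div]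
  have hsL : 0 < (ξ / ε) ^ L := Real.rpow_pos_of_pos hs L
  have hA : (ξ / ε) ^ 2 / (1 + (ξ / ε) ^ 2) ≤ 1 := by
    rw [div_le_one (by positivity)]; linarith [sq_nonneg (ξ / ε)]
  have hB : (ξ / ε) ^ L / (1 + (ξ / ε) ^ L) ≤ 1 := by
    rw [div_le_one (by positivity)]; linarith
  have h1 : ((ξ / ε) ^ 2 / (1 + (ξ / ε) ^ 2)) ^ a ≤ 1 := Real.rpow_le_one (by positivity) hA ha
  have h2 : ((ξ / ε) ^ L / (1 + (ξ / ε) ^ L)) ^ b ≤ 1 := Real.rpow_le_one (by positivity) hB hb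
  have h3 : 0 ≤ ξ ^ (2 * m) / ε ^ (2 * m) := by positivity
  have h4 : 0 ≤ ((ξ / ε) ^ 2 / (1 + (ξ / ε) ^ 2)) ^ a := Real.rpow_nonneg (by positivity) _
  calc ξ ^ (2 * m) / ε ^ (2 * m) * ((ξ / ε) ^ 2 / (1 + (ξ / ε) ^ 2)) ^ a * ((ξ / ε) ^ L / (1 + (ξ / ε) ^ L)) ^ b
      ≤ ξ ^ (2 * m) / ε ^ (2 * m) * 1 * 1 := by
        refine mul_le_mul (mul_le_mul_of_nonneg_left h1 h3) h2 (Real.rpow_nonneg (by positivity) _)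
          (by positivity)
    _ = ξ ^ (2 * m) / ε ^ (2 * m) := by ring

/-- Far-field lower bound `F(ξ) ≥ k₁ ξ^{2m}` for `ξ ≥ ρ₀ > 0`,
`k₁ = (ρ′²/(1+ρ′²))^a (ρ′^L/(1+ρ′^L))^b ε^{−2m}`, `ρ′ = ρ₀/ε`. -/
theorem scaledPlateau_ge_far {m a b L ε ρ₀ : ℝ} (ha : 0 ≤ a) (hb : 0 ≤ b) (hL : 0 < L) (hε : 0 < ε)
    (hρ₀ : 0 < ρ₀) {ξ : ℝ} (hξ : ρ₀ ≤ ξ) :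
    ((ρ₀ / ε) ^ 2 / (1 + (ρ₀ / ε) ^ 2)) ^ a * ((ρ₀ / ε) ^ L / (1 + (ρ₀ / ε) ^ L)) ^ b * (ε ^ (2 * m))⁻¹
        * ξ ^ (2 * m)
      ≤ (ξ / ε) ^ (2 * m + 2 * a + L * b) * (1 + (ξ / ε) ^ 2) ^ (-a) * (1 + (ξ / ε) ^ L) ^ (-b) := by
  have hξ0 : 0 < ξ := hρ₀.trans_le hξ
  have hs : 0 < ξ / ε := div_pos hξ0 hε
  have hr : 0 < ρ₀ / ε := div_pos hρ₀ hε
  have hrs : ρ₀ / ε ≤ ξ / ε := div_le_div_of_nonneg_right hξ hε.le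
  rw [plateauProfile_eq hs, Real.div_rpow hξ0.le hε.le (2 * m)]
  have hrL : 0 < (ρ₀ / ε) ^ L := Real.rpow_pos_of_pos hr L
  have hsL : 0 < (ξ / ε) ^ L := Real.rpow_pos_of_pos hs L
  -- monotonicity of `x ↦ x/(1+x)`
  have hA : (ρ₀ / ε) ^ 2 / (1 + (ρ₀ / ε) ^ 2) ≤ (ξ / ε) ^ 2 / (1 + (ξ / ε) ^ 2) := by
    have : (ρ₀ / ε) ^ 2 ≤ (ξ / ε) ^ 2 := pow_le_pow_left₀ hr.le hrs 2
    rw [div_le_div_iff₀ (by positivity) (by positivity)]; nlinarith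
  have hB : (ρ₀ / ε) ^ L / (1 + (ρ₀ / ε) ^ L) ≤ (ξ / ε) ^ L / (1 + (ξ / ε) ^ L) := by
    have : (ρ₀ / ε) ^ L ≤ (ξ / ε) ^ L := Real.rpow_le_rpow hr.le hrs hL.le
    rw [div_le_div_iff₀ (by positivity) (by positivity)]; nlinarith
  have h1 : ((ρ₀ / ε) ^ 2 / (1 + (ρ₀ / ε) ^ 2)) ^ a ≤ ((ξ / ε) ^ 2 / (1 + (ξ / ε) ^ 2)) ^ a :=
    Real.rpow_le_rpow (by positivity) hA ha
  have h2 : ((ρ₀ / ε) ^ L / (1 + (ρ₀ / ε) ^ L)) ^ b ≤ ((ξ / ε) ^ L / (1 + (ξ / ε) ^ L)) ^ b :=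
    Real.rpow_le_rpow (by positivity) hB hb
  have h3 : 0 ≤ ξ ^ (2 * m) / ε ^ (2 * m) := by positivity
  calc ((ρ₀ / ε) ^ 2 / (1 + (ρ₀ / ε) ^ 2)) ^ a * ((ρ₀ / ε) ^ L / (1 + (ρ₀ / ε) ^ L)) ^ b * (ε ^ (2 * m))⁻¹
          * ξ ^ (2 * m)
      = ξ ^ (2 * m) / ε ^ (2 * m) * (((ρ₀ / ε) ^ 2 / (1 + (ρ₀ / ε) ^ 2)) ^ a
          * ((ρ₀ / ε) ^ L / (1 + (ρ₀ / ε) ^ L)) ^ b) := by rw [div_eq_mul_inv (ξ ^ (2 * m))]; ring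
    _ ≤ ξ ^ (2 * m) / ε ^ (2 * m) * (((ξ / ε) ^ 2 / (1 + (ξ / ε) ^ 2)) ^ a
          * ((ξ / ε) ^ L / (1 + (ξ / ε) ^ L)) ^ b) := by
        refine mul_le_mul_of_nonneg_left ?_ h3
        exact mul_le_mul h1 h2 (Real.rpow_nonneg (by positivity) _) (Real.rpow_nonneg (by positivity) _)
    _ = ξ ^ (2 * m) / ε ^ (2 * m) * ((ξ / ε) ^ 2 / (1 + (ξ / ε) ^ 2)) ^ a
          * ((ξ / ε) ^ L / (1 + (ξ / ε) ^ L)) ^ b := by ring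

/-- Near-field lower bound `F(ξ) ≥ k₂ ξ²` on `[0, 2ρ₀]` (`0 < p = 2m+2a+Lb < 2`),
`k₂ = (2ρ′)^{p−2} (1+4ρ′²)^{−a} (1+(2ρ′)^L)^{−b} ε^{−2}`, `ρ′ = ρ₀/ε`. -/
theorem scaledPlateau_ge_near {p a b L ε ρ₀ : ℝ} (hp : 0 < p) (hp2 : p < 2) (ha : 0 ≤ a) (hb : 0 ≤ b)
    (hL : 0 < L) (hε : 0 < ε) (hρ₀ : 0 < ρ₀) {ξ : ℝ} (h0 : 0 ≤ ξ) (h2 : ξ ≤ 2 * ρ₀) :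
    (2 * (ρ₀ / ε)) ^ (p - 2) * (1 + 4 * (ρ₀ / ε) ^ 2) ^ (-a) * (1 + (2 * (ρ₀ / ε)) ^ L) ^ (-b) * (ε ^ 2)⁻¹
        * ξ ^ 2
      ≤ (ξ / ε) ^ p * (1 + (ξ / ε) ^ 2) ^ (-a) * (1 + (ξ / ε) ^ L) ^ (-b) := by
  rcases h0.eq_or_lt with h00 | hpos
  · rw [← h00, scaledPlateau_zero hp]; simp
  have hs : 0 < ξ / ε := div_pos hpos hε
  have hr : 0 < ρ₀ / ε := div_pos hρ₀ hε
  have hs2 : ξ / ε ≤ 2 * (ρ₀ / ε) := by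
    rw [mul_div_assoc']; exact div_le_div_of_nonneg_right h2 hε.le
  have hb2 : 0 < 1 + (ξ / ε) ^ 2 := by positivity
  have hsL : 0 < (ξ / ε) ^ L := Real.rpow_pos_of_pos hs L
  have hrL : 0 < (2 * (ρ₀ / ε)) ^ L := Real.rpow_pos_of_pos (by positivity) L
  -- `(ξ/ε)^p ≥ (2ρ′)^{p−2} (ξ/ε)²`
  have h1 : (2 * (ρ₀ / ε)) ^ (p - 2) * (ξ / ε) ^ 2 ≤ (ξ / ε) ^ p := by
    have e : (ξ / ε) ^ p = (ξ / ε) ^ (p - 2) * (ξ / ε) ^ 2 := by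
      rw [show (ξ / ε) ^ 2 = (ξ / ε) ^ (2 : ℝ) by norm_cast, ← Real.rpow_add hs]; ring_nf
    rw [e]
    exact mul_le_mul_of_nonneg_right (Real.rpow_le_rpow_of_nonpos hs hs2 (by linarith)) (sq_nonneg _)
  have h3 : (1 + 4 * (ρ₀ / ε) ^ 2) ^ (-a) ≤ (1 + (ξ / ε) ^ 2) ^ (-a) := by
    apply Real.rpow_le_rpow_of_nonpos hb2 _ (by linarith)
    nlinarith
  have h4 : (1 + (2 * (ρ₀ / ε)) ^ L) ^ (-b) ≤ (1 + (ξ / ε) ^ L) ^ (-b) := by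
    apply Real.rpow_le_rpow_of_nonpos (by positivity) _ (by linarith)
    have : (ξ / ε) ^ L ≤ (2 * (ρ₀ / ε)) ^ L := Real.rpow_le_rpow hs.le hs2 hL.le
    linarith
  have e2 : (2 * (ρ₀ / ε)) ^ (p - 2) * (1 + 4 * (ρ₀ / ε) ^ 2) ^ (-a) * (1 + (2 * (ρ₀ / ε)) ^ L) ^ (-b)
        * (ε ^ 2)⁻¹ * ξ ^ 2
      = ((2 * (ρ₀ / ε)) ^ (p - 2) * (ξ / ε) ^ 2) * (1 + 4 * (ρ₀ / ε) ^ 2) ^ (-a)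
        * (1 + (2 * (ρ₀ / ε)) ^ L) ^ (-b) := by
    rw [div_pow ξ ε 2]; field_simp
  rw [e2]
  have n1 : 0 ≤ (1 + 4 * (ρ₀ / ε) ^ 2) ^ (-a) := Real.rpow_nonneg (by positivity) _
  have n2 : 0 ≤ (1 + (2 * (ρ₀ / ε)) ^ L) ^ (-b) := Real.rpow_nonneg (by positivity) _
  have n3 : 0 ≤ (ξ / ε) ^ p := Real.rpow_nonneg hs.le _
  have n4 : 0 ≤ (1 + (ξ / ε) ^ 2) ^ (-a) := Real.rpow_nonneg hb2.le _
  calc ((2 * (ρ₀ / ε)) ^ (p - 2) * (ξ / ε) ^ 2) * (1 + 4 * (ρ₀ / ε) ^ 2) ^ (-a)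
        * (1 + (2 * (ρ₀ / ε)) ^ L) ^ (-b)
      ≤ (ξ / ε) ^ p * (1 + (ξ / ε) ^ 2) ^ (-a) * (1 + (2 * (ρ₀ / ε)) ^ L) ^ (-b) := by
        refine mul_le_mul_of_nonneg_right (mul_le_mul h1 h3 n1 n3) n2
    _ ≤ (ξ / ε) ^ p * (1 + (ξ / ε) ^ 2) ^ (-a) * (1 + (ξ / ε) ^ L) ^ (-b) :=
        mul_le_mul_of_nonneg_left h4 (mul_nonneg n3 n4)

/-! ## §2 The criterion with the plateau profile -/

/-- **One-sided criterion with the plateau Reynolds profile.**  Let `m > 0`, `2m ≤ 1`, `a, b ≥ 0`, `L > 0` with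
`p = 2m + 2a + Lb < 2`, `ε > 0`, `ν, T > 0`, and let `(u, p)` be a classical solution on `[0,T)` at viscosity `ν`,
Leray–Hopf from a rapidly decaying datum, with axisymmetric slices.  If on the unit tube `0 < r ≤ 1` the inflow
Reynolds number obeys `−r u_r/ν ≤ D(r/√(ν(T−t)))` with
`D(ξ) = 2 − N(s) + M(s)/N(s) + ε² s² (N(s) − 2m)/(2N(s))`, `s = ξ/ε`, `N(s) = 2m + 2a/(1+s²) + bL/(1+s^L)`,
`M(s) = 4as²/(1+s²)² + bL² s^L/(1+s^L)²`, then `u` extends smoothly past `T`.  Proof: the self-similar reduction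
`RadialInflowSelfSimilar.hasSmoothExtensionPast_of_reynoldsProfile` with the exact profile
`(ξ/ε)^p (1+(ξ/ε)²)^{−a} (1+(ξ/ε)^L)^{−b}` (`scaledPlateau_ode`) and its squeeze bounds.  (`b = 0`: the tree's
`D_{p,m,ε}` of `…CoreReynoldsScaled`.)  Readings of `D`: `≥ 2 − p` everywhere; `→ L + 2` where the `bL`-term dominates
`N` (the PLATEAU, at any distance from the axis); `→ 2 + ε²a/(2m)·…` far out. [new] -/
theorem hasSmoothExtensionPast_of_plateauCoreReynolds {m a b L ε ν T : ℝ}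
    {u : ℝ → EuclideanSpace ℝ (Fin 3) → EuclideanSpace ℝ (Fin 3)} {p : ℝ → EuclideanSpace ℝ (Fin 3) → ℝ}
    (hm : 0 < m) (h2m : 2 * m ≤ 1) (ha : 0 ≤ a) (hb : 0 ≤ b) (hL : 0 < L) (hp2 : 2 * m + 2 * a + L * b < 2)
    (hε : 0 < ε) (hν : 0 < ν) (hT : 0 < T)
    (hcl : IsClassicalNSSolutionOn (Ico 0 T) ν 0 u p) (hLH : IsLerayHopfOn T ν 0 (u 0) u)
    (hdec : HasRapidSpatialDecay (u 0)) (hax : ∀ t ∈ Ico 0 T, IsAxisymmetric (u t))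
    (henv : ∀ t ∈ Ico 0 T, ∀ x : EuclideanSpace ℝ (Fin 3), 0 < cylRadius x → cylRadius x ≤ 1 →
      -(ν * (2 - (2 * m + 2 * a / (1 + (cylRadius x / √(ν * (T - t)) / ε) ^ 2)
              + b * L / (1 + (cylRadius x / √(ν * (T - t)) / ε) ^ L))
            + (4 * a * (cylRadius x / √(ν * (T - t)) / ε) ^ 2
                  / (1 + (cylRadius x / √(ν * (T - t)) / ε) ^ 2) ^ 2
                + b * L ^ 2 * (cylRadius x / √(ν * (T - t)) / ε) ^ L
                  / (1 + (cylRadius x / √(ν * (T - t)) / ε) ^ L) ^ 2)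
              / (2 * m + 2 * a / (1 + (cylRadius x / √(ν * (T - t)) / ε) ^ 2)
                + b * L / (1 + (cylRadius x / √(ν * (T - t)) / ε) ^ L))
            + ε ^ 2 * (cylRadius x / √(ν * (T - t)) / ε) ^ 2
              * ((2 * m + 2 * a / (1 + (cylRadius x / √(ν * (T - t)) / ε) ^ 2)
                + b * L / (1 + (cylRadius x / √(ν * (T - t)) / ε) ^ L)) - 2 * m)
              / (2 * (2 * m + 2 * a / (1 + (cylRadius x / √(ν * (T - t)) / ε) ^ 2)
                + b * L / (1 + (cylRadius x / √(ν * (T - t)) / ε) ^ L))))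
          / cylRadius x) ≤ radialVelocity (u t) x) :
    HasSmoothExtensionPast ν 0 u T := by
  have hp : 0 < 2 * m + 2 * a + L * b := by nlinarith [mul_nonneg hL.le hb]
  have hρ₀ : 0 < rho (ν * T) 0 := rho_pos _ _
  have hk₁ : 0 < ((rho (ν * T) 0 / ε) ^ 2 / (1 + (rho (ν * T) 0 / ε) ^ 2)) ^ a
      * ((rho (ν * T) 0 / ε) ^ L / (1 + (rho (ν * T) 0 / ε) ^ L)) ^ b * (ε ^ (2 * m))⁻¹ := by
    have := Real.rpow_pos_of_pos (div_pos hρ₀ hε) L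
    positivity
  have hk₂ : 0 < (2 * (rho (ν * T) 0 / ε)) ^ (2 * m + 2 * a + L * b - 2) * (1 + 4 * (rho (ν * T) 0 / ε) ^ 2) ^ (-a)
      * (1 + (2 * (rho (ν * T) 0 / ε)) ^ L) ^ (-b) * (ε ^ 2)⁻¹ := by
    have := Real.rpow_pos_of_pos (show 0 < 2 * (rho (ν * T) 0 / ε) by positivity) L
    positivity
  have hC₀ : 0 < (ε ^ (2 * m))⁻¹ := by positivity
  have hmrel : 2 * a + b * L < 2 * m + 2 * a + L * b := by nlinarith
  exact hasSmoothExtensionPast_of_reynoldsProfile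
    (D := fun ξ => 2 - (2 * m + 2 * a / (1 + (ξ / ε) ^ 2) + b * L / (1 + (ξ / ε) ^ L))
        + (4 * a * (ξ / ε) ^ 2 / (1 + (ξ / ε) ^ 2) ^ 2 + b * L ^ 2 * (ξ / ε) ^ L / (1 + (ξ / ε) ^ L) ^ 2)
          / (2 * m + 2 * a / (1 + (ξ / ε) ^ 2) + b * L / (1 + (ξ / ε) ^ L))
        + ε ^ 2 * (ξ / ε) ^ 2 * ((2 * m + 2 * a / (1 + (ξ / ε) ^ 2) + b * L / (1 + (ξ / ε) ^ L)) - 2 * m)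
          / (2 * (2 * m + 2 * a / (1 + (ξ / ε) ^ 2) + b * L / (1 + (ξ / ε) ^ L))))
    (F := fun y : ℝ => (y / ε) ^ (2 * m + 2 * a + L * b) * (1 + (y / ε) ^ 2) ^ (-a) * (1 + (y / ε) ^ L) ^ (-b))
    hν hT hm h2m hC₀ hk₁ hk₂ (contDiffOn_scaledPlateau _ a b L hε) (continuousOn_scaledPlateau hp hL hε)
    (scaledPlateau_zero hp) (monotoneOn_scaledPlateau ha hb hL hε hmrel)
    (fun ξ hξ => scaledPlateau_le hm ha hb hL hε hξ)
    (fun ξ hξ => scaledPlateau_ge_far ha hb hL hε hρ₀ hξ)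
    (fun ξ h0 h2 => scaledPlateau_ge_near hp hp2 ha hb hL hε hρ₀ h0 h2)
    (fun ξ hξ => (scaledPlateau_ode hm ha hb hL.le hε hξ).le) hcl hLH hdec hax henv

end Summit.NavierStokesRegularity.NavierStokesRegularity.Theorems.RadialInflowPlateau

end
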